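import Summits.NavierStokesRegularity.NavierStokesRegularity.Theses.ExtremiserTransience
import Summits.NavierStokesRegularity.NavierStokesRegularity.Theorems.ExtremiserTransiencePerFlowLockedTimesLogDensity
import Summits.NavierStokesRegularity.NavierStokesRegularity.Theorems.ExtremiserTransienceNearExtremalTransienceDSSPerFlow
import HarnessLib

/-!
# Crux `NearExtremalTransience` (stmt-NavierStokesRegularity-21883) — LINE «static_slack» (ns-idea-10 g6, lens «rescuer»)
# Target BY NAME: `Theses.ExtremiserTransience.NearExtremalTransiencePerFlow` (stmt-…-26567, the live per-flow form of the crux).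

CORPSE RESCUED: my own withdrawn line «gevrey_slack» (rev C, 93fe73230dca: "analytic near-maximisers need a growing Gevrey
budget" — withdrawn for want of a MECHANISM producing slack, instrument I-GS1 null).  THE DODGE, as explicit stubs:
* the slack mechanism is now a theorem-backed compactness statement — `norm_eq_of_analytic_extremal` (p639524, landed today:
  an ANALYTIC admissible field attaining `κ⋆` has constant speed, hence is not `L²`/`L⁶`) makes the sharp inequality STRICT on
  analytic fields (`Lines/analytic_strictness_dss.lean: strict_of_analytic`, sorry-free), and at FIXED analyticity budget
  `(a, q)` and FIXED quanta number `𝒩 = √Z√P/M² ≤ N` the admissible class is compact modulo symmetries, so `κ⋆` is not even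
  APPROACHED there: `stub_analyticSlack` (static, classical profile-decomposition; provable, L);
* Type-I flows live at fixed analyticity budget in units of `√(ν(T−t))` (`stub_typeI_uniformAnalyticity`; Literature-grade:
  spatial analyticity radius `≳ √(ν·window)` for bounded mild solutions + Leray's lower blow-up rate; M/L);
* the single open enemy is split off as ONE flow-level crux with two numbers: `stub_noEfficientCrowds` — late slices with
  quanta number `> N` are uniformly inefficient (`≤ κ⋆ − η₀`).  This is the crowd/sheet enemy of 27695 `NoQuantumSheet` seen at
  single times of the actual flow: no zoom, no ancient solution, no Liouville theorem, no Oseen-identity transfer;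
* the tree's UNCONDITIONAL locked-times density (`PerFlow.lockedTimes_logDensity`, ns-idea-5 g4-α) supplies the set of late
  times (lower log-density `d₀ > 0`) on which the Taylor scale is `≲ √(ν(T−t))`, so that the flow's analyticity radius is a
  fixed fraction of the Taylor scale there and `stub_analyticSlack` bites.
ALTERNATIVE CUT (v1.1): `stub_uncrowdedLockedTimes` (S3′, purely kinematic: uncrowded locked late times are log-dense) with
its own kernel-checked composition `nearExtremalTransiencePerFlow_of_density : S1 → S2 → S3′ → 26567`.
COMPOSITION (kernel-checked, no sorry outside the stubs): on locked times the slice coefficient is `≤ κ⋆ − min(η,η₀)`, elsewhere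
`≤ κ⋆` (`flowwise_of_universal sharpDepletion_is_universal`); integrating against `dτ/(T−τ)` with the density bound gives the
per-flow certificate with `θ² = 1 − (κ⋆² − (κ⋆−η_m)²)·min(d₀,1)/κ⋆² < 1`.
HONEST FRAMING: a skeleton; statements about hypothetical Type-I singular flows; no summit is proved by a line. [folklore]
-/

noncomputable section

open Set Filter Topology MeasureTheory
open scoped InnerProductSpace RealInnerProductSpace ENNReal NNReal ContDiff
open Literature.Analysis.FluidPDE

namespace Summit.NavierStokesRegularity.NavierStokesRegularity.Cruxes.NearExtremalTransience.StaticSlack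
set_option linter.dupNamespace false
set_option linter.style.longLine false
set_option linter.unusedVariables false

open Summit.NavierStokesRegularity.NavierStokesRegularity.Theorems
open Summit.NavierStokesRegularity.NavierStokesRegularity.Theorems.DepletionLadder
open Summit.NavierStokesRegularity.NavierStokesRegularity.Theorems.RungReynoldsOne

/-- The sharp depletion constant `κ⋆ = sInf V` (spelled out exactly as in the route file). -/
def kStar : ℝ := sInf {κ : ℝ | (∀ (v : EuclideanSpace ℝ (Fin 3) → EuclideanSpace ℝ (Fin 3)) (M B : ℝ), ContDiff ℝ (⊤ : ℕ∞) v → Literature.Analysis.FluidPDE.VectorCalculus.IsDivFree v → (∀ x, ‖v x‖ ≤ M) → (∀ x, ‖fderiv ℝ v x‖ ≤ B) → (∫⁻ x, ‖iteratedFDeriv ℝ 0 v x‖ₑ ^ 2 < ⊤) → (∫⁻ x, ‖iteratedFDeriv ℝ 1 v x‖ₑ ^ 2 < ⊤) → (∫⁻ x, ‖iteratedFDeriv ℝ 2 v x‖ₑ ^ 2 < ⊤) → |∫ x, ⟪Literature.Analysis.FluidPDE.curl v x, fderiv ℝ v x (Literature.Analysis.FluidPDE.curl v x)⟫_ℝ|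 ≤ κ * M * Real.sqrt (∫ x, ‖Literature.Analysis.FluidPDE.curl v x‖ ^ 2) * Real.sqrt (∫ x, Literature.Analysis.FluidPDE.frobeniusNormSq (fderiv ℝ (Literature.Analysis.FluidPDE.curl v) x)))}

/-- STUB S1 (static, support-grade, size L) **Analytic slack at fixed budget and quanta number.**  For every amplitude ratio
`a`, radius ratio `q` and quanta bound `N` there is `η > 0` such that every admissible `L²`-class field whose derivatives obey
the analytic bounds `‖Dᵏv‖_∞ ≤ A·k!/ρᵏ` with `A ≤ a·M`, `q·Z ≤ ρ²·P` (radius at least `√q` Taylor scales) and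
`√Z√P ≤ N·M²` (at most `N` quanta) satisfies the sharp inequality with constant `κ⋆ − η`.
WHY PLAUSIBLY TRUE: the class is scale/translation invariant and compact modulo those symmetries (Arzelà–Ascoli from the
analytic bounds; no vanishing since each piece carries `≥ 𝒩_min` quanta; dichotomy harmless for the efficiency by
Cauchy–Schwarz; far pieces' induced strain `≤ ‖ω_far‖₂·D^{-3/2} → 0`); a maximising sequence at value `κ⋆` would converge to
an analytic extended-class attainer with `‖v‖₆ ≤ C√N`, contradicting constant speed (`norm_eq_of_analytic_extremal`).
WHY IT MIGHT FAIL: cross terms of the cubic `J` between separating pieces in the profile decomposition (dipole tails);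
the `L∞` constraint makes the class non-convex. [folklore]  REMARKS (critic V62): «no vanishing» is not a hypothesis — by Agmon
`‖v‖_∞² ≲ ‖∇v‖₂‖∇²v‖₂` every admissible field has `𝒩 ≥ 𝒩_min > 0` once `M ≈ sup|v|` (maximising sequences have that), so a bounded-`𝒩`
sequence splits into ≤ N/𝒩_min separating pieces. FIRST PROVER TARGET (P2, standalone lemma before the compactness run): the cubic
cross-term bound — for admissible `v = v₁ + v₂` with `dist(supp-essential(ω₁), supp-essential(ω₂)) ≥ D` (Gaussian-tail sense),
`|J(v) − J(v₁) − J(v₂)| ≤ C·(‖ω₁‖₂‖ω₂‖₂)(‖∇v₁‖_∞ + ‖∇v₂‖_∞)·e^{−cD²/ρ²} + (Biot–Savart strain tail) C·‖ω₁‖₂²‖ω₂‖₁·D^{−3}`; the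
dichotomy `R(v) ≤ max(R(v₁),R(v₂)) + o_D(1)` follows since `M ≥ max Mᵢ`, `Z ≈ Z₁+Z₂`, `P ≈ P₁+P₂`. -/
def AnalyticSlack : Prop :=
  ∀ a q N : ℝ, 0 < a → 0 < q → 0 < N → ∃ η : ℝ, 0 < η ∧
    ∀ (v : EuclideanSpace ℝ (Fin 3) → EuclideanSpace ℝ (Fin 3)) (M B A ρ : ℝ), ContDiff ℝ (⊤ : ℕ∞) v → Literature.Analysis.FluidPDE.VectorCalculus.IsDivFree v → (∀ x, ‖v x‖ ≤ M) → (∀ x, ‖fderiv ℝ v x‖ ≤ B) → (∫⁻ x, ‖iteratedFDeriv ℝ 0 v x‖ₑ ^ 2 < ⊤) → (∫⁻ x, ‖iteratedFDeriv ℝ 1 v x‖ₑ ^ 2 < ⊤) → (∫⁻ x, ‖iteratedFDeriv ℝ 2 v x‖ₑ ^ 2 < ⊤) → 0 < ρ →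
      (∀ (k : ℕ) (x : EuclideanSpace ℝ (Fin 3)), ‖iteratedFDeriv ℝ k v x‖ ≤ A * (k.factorial : ℝ) / ρ ^ k) → A ≤ a * M →
      q * (∫ x, ‖Literature.Analysis.FluidPDE.curl v x‖ ^ 2) ≤ ρ ^ 2 * (∫ x, Literature.Analysis.FluidPDE.frobeniusNormSq (fderiv ℝ (Literature.Analysis.FluidPDE.curl v) x)) →
      Real.sqrt (∫ x, ‖Literature.Analysis.FluidPDE.curl v x‖ ^ 2) * Real.sqrt (∫ x, Literature.Analysis.FluidPDE.frobeniusNormSq (fderiv ℝ (Literature.Analysis.FluidPDE.curl v) x)) ≤ N * M ^ 2 →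
      |∫ x, ⟪Literature.Analysis.FluidPDE.curl v x, fderiv ℝ v x (Literature.Analysis.FluidPDE.curl v x)⟫_ℝ| ≤ (kStar - η) * M * Real.sqrt (∫ x, ‖Literature.Analysis.FluidPDE.curl v x‖ ^ 2) * Real.sqrt (∫ x, Literature.Analysis.FluidPDE.frobeniusNormSq (fderiv ℝ (Literature.Analysis.FluidPDE.curl v) x))

theorem stub_analyticSlack : AnalyticSlack := by
  sorry

/-- STUB S2 (support-grade, Literature-level, size M/L) **Type-I flows have a uniform analyticity budget in parabolic units.**
For a Type-I singular classical flow there are `a, r > 0` and an onset `t₁` such that every late slice `u(t)` obeys analytic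
derivative bounds `‖Dᵏu(t)‖_∞ ≤ A·k!/ρᵏ` with radius `ρ² ≥ r·ν(T−t)` and amplitude `A ≤ a·sup|u(t)|`.
WHY PLAUSIBLY TRUE: spatial analyticity of bounded mild solutions with radius `≳ √(ν·window)` (Lemarié-Rieusset 2016 Thm 9.12
family; tree: `analytic_of_bounded_mild_L3_holds`, `lemarieRieusset2016_local_analyticity_holds`) on the window
`[t − (T−t)/C², t]` where `|u| ≤ 2C√ν/√(T−t)`, plus Leray's lower blow-up rate `sup|u(t)| ≥ c√ν/√(T−t)` for the amplitude ratio.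
WHY IT MIGHT FAIL: only bookkeeping (uniform constants in the analyticity estimate); Literature-grade. [folklore]  NAMED INGREDIENTS (critic V62 P3): (i) Leray's lower rate
`‖u(t)‖_∞ ≥ c√ν(T−t)^{-1/2}` at EVERY late time — tree theorem `Literature.Analysis.FluidPDE.leray_blowup_rate_top_holds`
(proved, `NSLerayBlowupRateTopHolds.lean`; turns `A ≤ a′·C√ν/√(T−t)` into `A ≤ a·sup|u(t)|`); (ii) Grujić–Kukavica / Lemarié-Rieusset
Thm 9.12 uniform analyticity radius `√(ν s)/C′(C)` after time `s` for data of size `C√ν/√(T−t₀)` on the window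
`[t−(T−t)/2, t]`; (iii) `RungReynoldsOne.stub_taoCover` for the L²-class membership of late slices (already used in the composition). -/
def TypeIUniformAnalyticity : Prop :=
  ∀ (C ν T : ℝ), 0 < C → 0 < ν → 0 < T → ∀ (u : ℝ → EuclideanSpace ℝ (Fin 3) → EuclideanSpace ℝ (Fin 3)) (p : ℝ → EuclideanSpace ℝ (Fin 3) → ℝ), Literature.Analysis.FluidPDE.IsClassicalNSSolutionOn (Set.Ico 0 T) ν 0 u p → Literature.Analysis.FluidPDE.IsLerayHopfOn T ν 0 (u 0) u → Literature.Analysis.FluidPDE.HasRapidSpatialDecay (u 0) → (∀ᶠ t in 𝓝[<] T, ∀ x, Real.sqrt (T - t) * ‖u t x‖ ≤ C * Real.sqrt ν) → ¬ Literature.Analysis.FluidPDE.HasSmoothExtensionPast ν 0 u T →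
    ∃ a r : ℝ, 0 < a ∧ 0 < r ∧ ∃ t₁ ∈ Set.Ico 0 T, ∀ t ∈ Set.Ico t₁ T, ∃ A ρ : ℝ, 0 < ρ ∧
      (∀ (k : ℕ) (x : EuclideanSpace ℝ (Fin 3)), ‖iteratedFDeriv ℝ k (u t) x‖ ≤ A * (k.factorial : ℝ) / ρ ^ k) ∧
      (∀ M : ℝ, (∀ x, ‖u t x‖ ≤ M) → A ≤ a * M) ∧ r * (ν * (T - t)) ≤ ρ ^ 2

theorem stub_typeI_uniformAnalyticity : TypeIUniformAnalyticity := by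
  sorry

/-- STUB S3 — THE CRUX of the line (size XL) **No efficient crowds at late times of a Type-I singular flow.**  There are
`N, η₀ > 0` and an onset `t₁` such that every late slice whose quanta number exceeds `N` (`N·M² < √Z√P` for a bound `M` of
`|u(t)|`) satisfies the sharp inequality with constant `κ⋆ − η₀`.
WHY IT MIGHT FAIL: the crowd/sheet enemy of 27695 `NoQuantumSheet`, seen at single times: the numerical near-maximisers of the
efficiency are periodic crystals (instrument I-GS1: `R ≈ 0.1444–0.1447` on `𝕋³` trig polynomials vs `0.1444` for the best
`L²` molecule, j021500), so efficient crowds exist AS FIELDS; the stub bets they do not occur as late slices of a Type-I flow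
(finite energy `Σ𝒩_k(T−t_k)^{1/2} < ∞` is the only a-priori constraint, B5-5).  Sources: KNSS2009 (arXiv:0709.3599), 27695's
why-fail, HANDOFF B5-5/B6-1. [folklore] -/
def NoEfficientCrowds : Prop :=
  ∀ (C ν T : ℝ), 0 < C → 0 < ν → 0 < T → ∀ (u : ℝ → EuclideanSpace ℝ (Fin 3) → EuclideanSpace ℝ (Fin 3)) (p : ℝ → EuclideanSpace ℝ (Fin 3) → ℝ), Literature.Analysis.FluidPDE.IsClassicalNSSolutionOn (Set.Ico 0 T) ν 0 u p → Literature.Analysis.FluidPDE.IsLerayHopfOn T ν 0 (u 0) u → Literature.Analysis.FluidPDE.HasRapidSpatialDecay (u 0) → (∀ᶠ t in 𝓝[<] T, ∀ x, Real.sqrt (T - t) * ‖u t x‖ ≤ C * Real.sqrt ν) → ¬ Literature.Analysis.FluidPDE.HasSmoothExtensionPast ν 0 u T →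
    ∃ N η₀ : ℝ, 0 < N ∧ 0 < η₀ ∧ ∃ t₁ ∈ Set.Ico 0 T, ∀ t ∈ Set.Ico t₁ T, ∀ M : ℝ, (∀ x, ‖u t x‖ ≤ M) →
      N * M ^ 2 < Real.sqrt (∫ x, ‖Literature.Analysis.FluidPDE.curl (u t) x‖ ^ 2) * Real.sqrt (∫ x, Literature.Analysis.FluidPDE.frobeniusNormSq (fderiv ℝ (Literature.Analysis.FluidPDE.curl (u t)) x)) →
      |∫ x, ⟪Literature.Analysis.FluidPDE.curl (u t) x, fderiv ℝ (u t) x (Literature.Analysis.FluidPDE.curl (u t) x)⟫_ℝ| ≤ (kStar - η₀) * M * Real.sqrt (∫ x, ‖Literature.Analysis.FluidPDE.curl (u t) x‖ ^ 2) * Real.sqrt (∫ x, Literature.Analysis.FluidPDE.frobeniusNormSq (fderiv ℝ (Literature.Analysis.FluidPDE.curl (u t)) x))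

theorem stub_noEfficientCrowds : NoEfficientCrowds := by
  sorry


/-- STUB S3′ — ALTERNATIVE (weaker, purely kinematic) CRUX for the density composition (size XL) **Uncrowded locked late times
are log-dense.**  There are `N, c, d > 0` (all three positive; critic V65) such that past every onset `t₁` the late times at which the slice is scale-locked
(`Z ≤ c·ν(T−t)·P`) AND carries at most `N` quanta (`√Z√P ≤ N·|u(t,x₀)|²` for some point `x₀` — a sup-free way of saying
`𝒩(t) ≤ N`) contain a measurable set of lower log-density `≥ d`.  No efficiency, no `κ⋆` in the statement: it is exactly the gap
left by the energy budget (B5-5: `∫𝒩(t)(T−t)^{-1/2}dt < ∞` allows crowd-dominated blow-up).  With `N = ∞` it is the tree's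
`PerFlow.lockedTimes_logDensity`.
WHY IT MIGHT FAIL: crowd-dominated Type-I blow-up (`𝒩(t) → ∞` along a set of times of log-density one) is not excluded by any known
a-priori estimate (energy, Constantin's `sup_t ‖ω‖_{L¹}`); it is the flow-level face of 27695's sheet enemy. Sources: as S3. [folklore] -/
def UncrowdedLockedTimes : Prop :=
  ∀ (C ν T : ℝ), 0 < C → 0 < ν → 0 < T → ∀ (u : ℝ → EuclideanSpace ℝ (Fin 3) → EuclideanSpace ℝ (Fin 3)) (p : ℝ → EuclideanSpace ℝ (Fin 3) → ℝ), Literature.Analysis.FluidPDE.IsClassicalNSSolutionOn (Set.Ico 0 T) ν 0 u p → Literature.Analysis.FluidPDE.IsLerayHopfOn T ν 0 (u 0) u → Literature.Analysis.FluidPDE.HasRapidSpatialDecay (u 0) → (∀ᶠ t in 𝓝[<] T, ∀ x, Real.sqrt (T - t) * ‖u t x‖ ≤ C * Real.sqrt ν) → ¬ Literature.Analysis.FluidPDE.HasSmoothExtensionPast ν 0 u T →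
    ∃ N c d : ℝ, 0 < N ∧ 0 < c ∧ 0 < d ∧ ∀ t₁ ∈ Set.Ico 0 T, ∃ S : Set ℝ, MeasurableSet S ∧
      S ⊆ {t : ℝ | t ∈ Set.Ico t₁ T ∧ (∫ x, ‖Literature.Analysis.FluidPDE.curl (u t) x‖ ^ 2) ≤ c * (ν * (T - t)) * (∫ x, Literature.Analysis.FluidPDE.frobeniusNormSq (fderiv ℝ (Literature.Analysis.FluidPDE.curl (u t)) x)) ∧
        ∃ x₀ : EuclideanSpace ℝ (Fin 3), Real.sqrt (∫ x, ‖Literature.Analysis.FluidPDE.curl (u t) x‖ ^ 2) * Real.sqrt (∫ x, Literature.Analysis.FluidPDE.frobeniusNormSq (fderiv ℝ (Literature.Analysis.FluidPDE.curl (u t)) x)) ≤ N * ‖u t x₀‖ ^ 2} ∧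
      ∃ c' : ℝ, ∀ t ∈ Set.Ico t₁ T,
        d * Real.log ((T - t₁) / (T - t)) - c' ≤ ∫ τ in t₁..t, S.indicator (fun _ => (1 : ℝ)) τ / (T - τ)

theorem stub_uncrowdedLockedTimes : UncrowdedLockedTimes := by
  sorry

/-! ## Composition (kernel-checked): S1 → S2 → S3 → `NearExtremalTransiencePerFlow` -/

theorem kStar_pos : 0 < kStar := lt_trans (by norm_num) sharpDepletion_gt

theorem kStar_le_one : kStar ≤ 1 := by
  have h := sharpDepletion_le_lambSplit
  have h15 : Real.sqrt 15 ≤ 4 := by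
    rw [show (4:ℝ) = Real.sqrt 16 by rw [show (16:ℝ) = 4 ^ 2 by norm_num, Real.sqrt_sq (by norm_num)]]
    exact Real.sqrt_le_sqrt (by norm_num)
  have : (9 + 2 * Real.sqrt 15) / 42 ≤ 1 := by
    rw [div_le_one (by norm_num)]; linarith
  exact le_trans h this

theorem kStar_le_of_universal {κ : ℝ}
    (hκ : ∀ (v : EuclideanSpace ℝ (Fin 3) → EuclideanSpace ℝ (Fin 3)) (M B : ℝ), ContDiff ℝ (⊤ : ℕ∞) v → Literature.Analysis.FluidPDE.VectorCalculus.IsDivFree v → (∀ x, ‖v x‖ ≤ M) → (∀ x, ‖fderiv ℝ v x‖ ≤ B) → (∫⁻ x, ‖iteratedFDeriv ℝ 0 v x‖ₑ ^ 2 < ⊤) → (∫⁻ x, ‖iteratedFDeriv ℝ 1 v x‖ₑ ^ 2 < ⊤) → (∫⁻ x, ‖iteratedFDeriv ℝ 2 v x‖ₑ ^ 2 < ⊤) →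
      |∫ x, ⟪Literature.Analysis.FluidPDE.curl v x, fderiv ℝ v x (Literature.Analysis.FluidPDE.curl v x)⟫_ℝ| ≤ κ * M * Real.sqrt (∫ x, ‖Literature.Analysis.FluidPDE.curl v x‖ ^ 2) * Real.sqrt (∫ x, Literature.Analysis.FluidPDE.frobeniusNormSq (fderiv ℝ (Literature.Analysis.FluidPDE.curl v) x))) : kStar ≤ κ :=
  sharpDepletion_le hκ

set_option maxHeartbeats 1600000 in
/-- **LINE «static_slack» concludes the live per-flow crux BY NAME.** -/
theorem nearExtremalTransiencePerFlow_of :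
    AnalyticSlack → TypeIUniformAnalyticity → NoEfficientCrowds →
      Summit.NavierStokesRegularity.NavierStokesRegularity.Theses.ExtremiserTransience.NearExtremalTransiencePerFlow := by
  intro hS1 hS2 hS3 C ν T hC hν hT u p hsol hLH hdec hrate hext
  classical
  -- the three inputs for this flow
  obtain ⟨a, r, ha, hr, t₁a, ht₁a, hA⟩ := hS2 C ν T hC hν hT u p hsol hLH hdec hrate hext
  obtain ⟨N, η₀, hN, hη₀, t₁c, ht₁c, hCr⟩ := hS3 C ν T hC hν hT u p hsol hLH hdec hrate hext
  obtain ⟨c₂, d₀, hd₀, hlock⟩ := PerFlow.lockedTimes_logDensity hC hν hT hsol hLH hdec hrate hext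
  -- radius ratio on locked times
  set m : ℝ := max c₂ 1 with hm
  have hm1 : 1 ≤ m := le_max_right _ _
  have hm0 : 0 < m := lt_of_lt_of_le one_pos hm1
  have hc₂m : c₂ ≤ m := le_max_left _ _
  set q : ℝ := r / m with hq
  have hq0 : 0 < q := div_pos hr hm0
  obtain ⟨η, hη, hslack⟩ := hS1 a q N ha hq0 hN
  -- onset and the locked set
  set t₁ : ℝ := max t₁a t₁c with ht₁def
  have ht₁ : t₁ ∈ Set.Ico 0 T := ⟨le_trans ht₁a.1 (le_max_left _ _), max_lt ht₁a.2 ht₁c.2⟩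
  obtain ⟨S, hSm, hSsub, c, hdens⟩ := hlock t₁ ht₁
  -- constants
  have hK0 : 0 < kStar := kStar_pos
  have hK1 : kStar ≤ 1 := kStar_le_one
  set ηm : ℝ := min (min η η₀) kStar with hηm
  have hηm0 : 0 < ηm := lt_min (lt_min hη hη₀) hK0
  have hηmη : ηm ≤ η := le_trans (min_le_left _ _) (min_le_left _ _)
  have hηmη₀ : ηm ≤ η₀ := le_trans (min_le_left _ _) (min_le_right _ _)
  have hηmK : ηm ≤ kStar := min_le_right _ _
  set δ : ℝ := kStar ^ 2 - (kStar - ηm) ^ 2 with hδ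
  have hδ0 : 0 < δ := by rw [hδ]; nlinarith
  have hδK : δ ≤ kStar ^ 2 := by rw [hδ]; nlinarith
  set d : ℝ := min d₀ 1 with hd
  have hd0 : 0 < d := lt_min hd₀ one_pos
  have hd1 : d ≤ 1 := min_le_right _ _
  have hdd₀ : d ≤ d₀ := min_le_left _ _
  have hθsq0 : 0 ≤ 1 - δ * d / kStar ^ 2 := by
    rw [sub_nonneg, div_le_one (by positivity)]
    calc δ * d ≤ kStar ^ 2 * 1 := mul_le_mul hδK hd1 hd0.le (by positivity)
      _ = kStar ^ 2 := mul_one _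
  have hθsq1 : 1 - δ * d / kStar ^ 2 < 1 := by
    have : 0 < δ * d / kStar ^ 2 := by positivity
    linarith
  set θ : ℝ := Real.sqrt (1 - δ * d / kStar ^ 2) with hθ
  have hθ0 : 0 ≤ θ := Real.sqrt_nonneg _
  have hθ1 : θ < 1 := by
    rw [hθ, Real.sqrt_lt' one_pos, one_pow]
    exact hθsq1
  have hθsq : θ ^ 2 = 1 - δ * d / kStar ^ 2 := by rw [hθ, Real.sq_sqrt hθsq0]
  -- the coefficient: `κ⋆ − ηm` on the locked set, `κ⋆` elsewhere
  set k : ℝ → ℝ := fun τ => kStar - ηm * S.indicator (fun _ => (1:ℝ)) τ with hk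
  have hind01 : ∀ τ, S.indicator (fun _ => (1:ℝ)) τ = 0 ∨ S.indicator (fun _ => (1:ℝ)) τ = 1 := by
    intro τ; by_cases hτ : τ ∈ S
    · right; simp [Set.indicator_of_mem hτ]
    · left; simp [Set.indicator_of_notMem hτ]
  have hkm : Measurable k :=
    measurable_const.sub (measurable_const.mul (measurable_const.indicator hSm))
  have hk01 : ∀ τ, 0 ≤ k τ ∧ k τ ≤ 1 := by
    intro τ; rcases hind01 τ with h | h <;> simp only [hk, h, mul_zero, mul_one, sub_zero]
    · exact ⟨hK0.le, hK1⟩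
    · exact ⟨by linarith, by linarith⟩
  have hksq : ∀ τ, k τ ^ 2 = kStar ^ 2 - δ * S.indicator (fun _ => (1:ℝ)) τ := by
    intro τ; rcases hind01 τ with h | h <;> simp only [hk, h, mul_zero, mul_one, sub_zero, hδ] <;> ring
  -- the flow-wise sharp bound at every time
  have hFW := flowwise_of_universal sharpDepletion_is_universal hν hT hsol hLH hdec
  refine ⟨θ, hθ0, hθ1, fun κ hκ => ⟨t₁, ht₁, k, δ * c, hkm, hk01, ?_, ?_⟩⟩
  · -- validity of the coefficient on `[t₁, T)`
    intro t ht M hM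
    have ht0 : t ∈ Set.Ico 0 T := ⟨le_trans ht₁.1 ht.1, ht.2⟩
    have hM0 : 0 ≤ M := le_trans (norm_nonneg _) (hM 0)
    set Z : ℝ := (∫ x, ‖Literature.Analysis.FluidPDE.curl (u t) x‖ ^ 2) with hZ
    set P : ℝ := (∫ x, Literature.Analysis.FluidPDE.frobeniusNormSq (fderiv ℝ (Literature.Analysis.FluidPDE.curl (u t)) x)) with hP
    have hZ0 : 0 ≤ Z := integral_nonneg fun x => sq_nonneg _
    have hP0 : 0 ≤ P := integral_nonneg fun x => frobeniusNormSq_nonneg _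
    have hD0 : 0 ≤ M * Real.sqrt Z * Real.sqrt P := by positivity
    have hJK : |∫ x, ⟪Literature.Analysis.FluidPDE.curl (u t) x, fderiv ℝ (u t) x (Literature.Analysis.FluidPDE.curl (u t) x)⟫_ℝ| ≤ kStar * M * Real.sqrt Z * Real.sqrt P := hFW t ht0 M hM
    by_cases htS : t ∈ S
    · -- locked time: coefficient `κ⋆ − ηm`
      have hkt : k t = kStar - ηm := by simp [hk, Set.indicator_of_mem htS]
      rw [hkt]
      have hlockt := (hSsub htS).2
      by_cases hcrowd : N * M ^ 2 < Real.sqrt Z * Real.sqrt P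
      · -- crowded: S3
        have h3 := hCr t ⟨le_trans (le_max_right _ _) ht.1, ht.2⟩ M hM hcrowd
        calc |∫ x, ⟪Literature.Analysis.FluidPDE.curl (u t) x, fderiv ℝ (u t) x (Literature.Analysis.FluidPDE.curl (u t) x)⟫_ℝ| ≤ (kStar - η₀) * M * Real.sqrt Z * Real.sqrt P := h3
          _ ≤ (kStar - ηm) * M * Real.sqrt Z * Real.sqrt P := by
            have : (kStar - η₀) ≤ (kStar - ηm) := by linarith
            calc (kStar - η₀) * M * Real.sqrt Z * Real.sqrt P = (kStar - η₀) * (M * Real.sqrt Z * Real.sqrt P) := by ring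
              _ ≤ (kStar - ηm) * (M * Real.sqrt Z * Real.sqrt P) := mul_le_mul_of_nonneg_right this hD0
              _ = (kStar - ηm) * M * Real.sqrt Z * Real.sqrt P := by ring
      · -- uncrowded: S1 via S2 and the admissibility of the slice
        push Not at hcrowd
        obtain ⟨A, ρ, hρ, hder, hAM, hrρ⟩ := hA t ⟨le_trans (le_max_left _ _) ht.1, ht.2⟩
        -- admissibility of the slice `u t` (Tao cover)
        have ht' : (t + T) / 2 ∈ Ioo 0 T := ⟨by linarith [ht0.1], by linarith [ht0.2]⟩
        obtain ⟨qq, hsolt, hut, -, -⟩ := stub_taoCover hν hT hsol hLH hdec ht'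
        have htI : t ∈ Icc 0 ((t + T) / 2) := ⟨ht0.1, by linarith [ht0.2]⟩
        obtain ⟨C₀, hC₀⟩ := hut 0
        obtain ⟨C₁, hC₁⟩ := hut 1
        obtain ⟨C₂, hC₂⟩ := hut 2
        obtain ⟨B₁, -, hB₁⟩ := exists_forall_norm_fderiv_le_of_hasBoundedSobolevNormsOn
          (fun s hs => (hsolt.contDiff_velocity hs).of_le (by norm_cast)) hut
        have h0 : ∫⁻ x, ‖iteratedFDeriv ℝ 0 (u t) x‖ₑ ^ 2 < ⊤ := (hC₀ t htI).trans_lt ENNReal.coe_lt_top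
        have h1 : ∫⁻ x, ‖iteratedFDeriv ℝ 1 (u t) x‖ₑ ^ 2 < ⊤ := (hC₁ t htI).trans_lt ENNReal.coe_lt_top
        have h2 : ∫⁻ x, ‖iteratedFDeriv ℝ 2 (u t) x‖ₑ ^ 2 < ⊤ := (hC₂ t htI).trans_lt ENNReal.coe_lt_top
        have hcd : ContDiff ℝ (⊤ : ℕ∞) (u t) := hsol.contDiff_velocity ht0
        have hdiv : VectorCalculus.IsDivFree (u t) := hsol.divFree t ht0
        -- radius at least `√q` Taylor scales on a locked time
        have hνt : 0 ≤ ν * (T - t) := by have := ht.2; nlinarith [hν.le]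
        have hqZ : q * Z ≤ ρ ^ 2 * P := by
          have h1' : Z ≤ m * (ν * (T - t)) * P := by
            calc Z ≤ c₂ * (ν * (T - t)) * P := hlockt
              _ ≤ m * (ν * (T - t)) * P := by
                have := mul_le_mul_of_nonneg_right (mul_le_mul_of_nonneg_right hc₂m hνt) hP0
                exact this
          have h2' : r * (m * (ν * (T - t)) * P) ≤ m * (ρ ^ 2 * P) := by
            have h3 : m * (r * (ν * (T - t))) ≤ m * ρ ^ 2 := mul_le_mul_of_nonneg_left hrρ hm0.le
            have h4 : m * (r * (ν * (T - t))) * P ≤ m * ρ ^ 2 * P := mul_le_mul_of_nonneg_right h3 hP0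
            calc r * (m * (ν * (T - t)) * P) = m * (r * (ν * (T - t))) * P := by ring
              _ ≤ m * ρ ^ 2 * P := h4
              _ = m * (ρ ^ 2 * P) := by ring
          rw [hq, div_mul_eq_mul_div, div_le_iff₀ hm0]
          calc r * Z ≤ r * (m * (ν * (T - t)) * P) := mul_le_mul_of_nonneg_left h1' hr.le
            _ ≤ m * (ρ ^ 2 * P) := h2'
            _ = ρ ^ 2 * P * m := by ring
        have hS1t := hslack (u t) M B₁ A ρ hcd hdiv hM (hB₁ t htI) h0 h1 h2 hρ hder (hAM M hM) hqZ hcrowd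
        calc |∫ x, ⟪Literature.Analysis.FluidPDE.curl (u t) x, fderiv ℝ (u t) x (Literature.Analysis.FluidPDE.curl (u t) x)⟫_ℝ| ≤ (kStar - η) * M * Real.sqrt Z * Real.sqrt P := hS1t
          _ ≤ (kStar - ηm) * M * Real.sqrt Z * Real.sqrt P := by
            have : (kStar - η) ≤ (kStar - ηm) := by linarith
            calc (kStar - η) * M * Real.sqrt Z * Real.sqrt P = (kStar - η) * (M * Real.sqrt Z * Real.sqrt P) := by ring
              _ ≤ (kStar - ηm) * (M * Real.sqrt Z * Real.sqrt P) := mul_le_mul_of_nonneg_right this hD0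
              _ = (kStar - ηm) * M * Real.sqrt Z * Real.sqrt P := by ring
    · -- unlocked time: coefficient `κ⋆`
      have hkt : k t = kStar := by simp [hk, Set.indicator_of_notMem htS]
      rw [hkt]; exact hJK
  · -- the log-mean bound
    intro t ht
    have hKκ : kStar ≤ κ := kStar_le_of_universal hκ
    have hκ0 : 0 ≤ κ := le_trans hK0.le hKκ
    have hL0 : 0 ≤ Real.log ((T - t₁) / (T - t)) := by
      apply Real.log_nonneg
      rw [le_div_iff₀ (by linarith [ht.2])]; linarith [ht.1]
    set L : ℝ := Real.log ((T - t₁) / (T - t)) with hLdef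
    -- integrability
    have hInd : IntervalIntegrable (fun s => S.indicator (fun _ => (1:ℝ)) s / (T - s)) volume t₁ t := by
      have h := intervalIntegrable_coeff_sq_div (k := S.indicator (fun _ => (1:ℝ))) (T := T)
        (measurable_const.indicator hSm) (fun τ => by rcases hind01 τ with h | h <;> simp [h]) ht.1 ht.2
      refine h.congr ?_
      · intro s _
        rcases hind01 s with h | h <;> simp [h]
    have hConst : IntervalIntegrable (fun s => kStar ^ 2 / (T - s)) volume t₁ t := by
      apply ContinuousOn.intervalIntegrable
      apply ContinuousOn.div continuousOn_const (continuousOn_const.sub continuousOn_id)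
      intro s hs
      rw [Set.uIcc_of_le ht.1] at hs
      have hsT : s < T := lt_of_le_of_lt hs.2 ht.2
      have hTs : T - s ≠ 0 := sub_ne_zero.mpr (ne_of_gt hsT)
      simpa [id] using hTs
    have hrew : ∫ τ in t₁..t, k τ ^ 2 / (T - τ)
        = ∫ τ in t₁..t, (kStar ^ 2 / (T - τ) - δ * (S.indicator (fun _ => (1:ℝ)) τ / (T - τ))) := by
      apply intervalIntegral.integral_congr
      intro τ _
      simp only [hksq τ]; ring
    rw [hrew, intervalIntegral.integral_sub hConst (hInd.const_mul δ), intervalIntegral.integral_const_mul,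
      integral_const_div_sub ht.1 ht.2]
    have hdens' := hdens t ht
    -- `−δ ∫ 1_S/(T−τ) ≤ δ (c − d₀ L) ≤ δ c − δ d L`
    have hstep : kStar ^ 2 * L - δ * ∫ τ in t₁..t, S.indicator (fun _ => (1:ℝ)) τ / (T - τ)
        ≤ (kStar ^ 2 - δ * d) * L + δ * c := by
      have h1 : δ * (d₀ * L - c) ≤ δ * ∫ τ in t₁..t, S.indicator (fun _ => (1:ℝ)) τ / (T - τ) :=
        mul_le_mul_of_nonneg_left hdens' hδ0.le
      have h2 : δ * d * L ≤ δ * d₀ * L := by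
        have := mul_le_mul_of_nonneg_left hdd₀ hδ0.le
        exact mul_le_mul_of_nonneg_right this hL0
      nlinarith
    have hθK : (kStar ^ 2 - δ * d) = (θ * kStar) ^ 2 := by
      rw [mul_pow, hθsq]; field_simp
    have hθκ : (θ * kStar) ^ 2 * L ≤ (θ * κ) ^ 2 * L := by
      apply mul_le_mul_of_nonneg_right _ hL0
      rw [mul_pow, mul_pow]
      exact mul_le_mul_of_nonneg_left (pow_le_pow_left₀ hK0.le hKκ 2) (sq_nonneg _)
    calc kStar ^ 2 * L - δ * ∫ τ in t₁..t, S.indicator (fun _ => (1:ℝ)) τ / (T - τ)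
        ≤ (kStar ^ 2 - δ * d) * L + δ * c := hstep
      _ = (θ * kStar) ^ 2 * L + δ * c := by rw [hθK]
      _ ≤ (θ * κ) ^ 2 * L + δ * c := by linarith

set_option maxHeartbeats 1600000 in
/-- **Density composition**: S1 → S2 → S3′ → the live per-flow crux BY NAME (no `κ⋆`-statement about crowds needed; the tree's
locked-times density is replaced by the stub's uncrowded-locked density). -/
theorem nearExtremalTransiencePerFlow_of_density :
    AnalyticSlack → TypeIUniformAnalyticity → UncrowdedLockedTimes →
      Summit.NavierStokesRegularity.NavierStokesRegularity.Theses.ExtremiserTransience.NearExtremalTransiencePerFlow := by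
  intro hS1 hS2 hS3 C ν T hC hν hT u p hsol hLH hdec hrate hext
  classical
  obtain ⟨a, r, ha, hr, t₁a, ht₁a, hA⟩ := hS2 C ν T hC hν hT u p hsol hLH hdec hrate hext
  obtain ⟨N, c₂, d₀, hN, -, hd₀, hlock⟩ := hS3 C ν T hC hν hT u p hsol hLH hdec hrate hext
  set m : ℝ := max c₂ 1 with hm
  have hm1 : 1 ≤ m := le_max_right _ _
  have hm0 : 0 < m := lt_of_lt_of_le one_pos hm1
  have hc₂m : c₂ ≤ m := le_max_left _ _
  set q : ℝ := r / m with hq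
  have hq0 : 0 < q := div_pos hr hm0
  obtain ⟨η, hη, hslack⟩ := hS1 a q N ha hq0 hN
  set t₁ : ℝ := t₁a with ht₁def
  have ht₁ : t₁ ∈ Set.Ico 0 T := ht₁a
  obtain ⟨S, hSm, hSsub, c, hdens⟩ := hlock t₁ ht₁
  have hK0 : 0 < kStar := kStar_pos
  have hK1 : kStar ≤ 1 := kStar_le_one
  set ηm : ℝ := min η kStar with hηm
  have hηm0 : 0 < ηm := lt_min hη hK0
  have hηmη : ηm ≤ η := min_le_left _ _
  have hηmK : ηm ≤ kStar := min_le_right _ _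
  set δ : ℝ := kStar ^ 2 - (kStar - ηm) ^ 2 with hδ
  have hδ0 : 0 < δ := by rw [hδ]; nlinarith
  have hδK : δ ≤ kStar ^ 2 := by rw [hδ]; nlinarith
  set d : ℝ := min d₀ 1 with hd
  have hd0 : 0 < d := lt_min hd₀ one_pos
  have hd1 : d ≤ 1 := min_le_right _ _
  have hdd₀ : d ≤ d₀ := min_le_left _ _
  have hθsq0 : 0 ≤ 1 - δ * d / kStar ^ 2 := by
    rw [sub_nonneg, div_le_one (by positivity)]
    calc δ * d ≤ kStar ^ 2 * 1 := mul_le_mul hδK hd1 hd0.le (by positivity)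
      _ = kStar ^ 2 := mul_one _
  have hθsq1 : 1 - δ * d / kStar ^ 2 < 1 := by
    have : 0 < δ * d / kStar ^ 2 := by positivity
    linarith
  set θ : ℝ := Real.sqrt (1 - δ * d / kStar ^ 2) with hθ
  have hθ0 : 0 ≤ θ := Real.sqrt_nonneg _
  have hθ1 : θ < 1 := by
    rw [hθ, Real.sqrt_lt' one_pos, one_pow]
    exact hθsq1
  have hθsq : θ ^ 2 = 1 - δ * d / kStar ^ 2 := by rw [hθ, Real.sq_sqrt hθsq0]
  set k : ℝ → ℝ := fun τ => kStar - ηm * S.indicator (fun _ => (1:ℝ)) τ with hk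
  have hind01 : ∀ τ, S.indicator (fun _ => (1:ℝ)) τ = 0 ∨ S.indicator (fun _ => (1:ℝ)) τ = 1 := by
    intro τ; by_cases hτ : τ ∈ S
    · right; simp [Set.indicator_of_mem hτ]
    · left; simp [Set.indicator_of_notMem hτ]
  have hkm : Measurable k :=
    measurable_const.sub (measurable_const.mul (measurable_const.indicator hSm))
  have hk01 : ∀ τ, 0 ≤ k τ ∧ k τ ≤ 1 := by
    intro τ; rcases hind01 τ with h | h <;> simp only [hk, h, mul_zero, mul_one, sub_zero]
    · exact ⟨hK0.le, hK1⟩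
    · exact ⟨by linarith, by linarith⟩
  have hksq : ∀ τ, k τ ^ 2 = kStar ^ 2 - δ * S.indicator (fun _ => (1:ℝ)) τ := by
    intro τ; rcases hind01 τ with h | h <;> simp only [hk, h, mul_zero, mul_one, sub_zero, hδ] <;> ring
  have hFW := flowwise_of_universal sharpDepletion_is_universal hν hT hsol hLH hdec
  refine ⟨θ, hθ0, hθ1, fun κ hκ => ⟨t₁, ht₁, k, δ * c, hkm, hk01, ?_, ?_⟩⟩
  · intro t ht M hM
    have ht0 : t ∈ Set.Ico 0 T := ⟨le_trans ht₁.1 ht.1, ht.2⟩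
    have hM0 : 0 ≤ M := le_trans (norm_nonneg _) (hM 0)
    set Z : ℝ := (∫ x, ‖Literature.Analysis.FluidPDE.curl (u t) x‖ ^ 2) with hZ
    set P : ℝ := (∫ x, Literature.Analysis.FluidPDE.frobeniusNormSq (fderiv ℝ (Literature.Analysis.FluidPDE.curl (u t)) x)) with hP
    have hZ0 : 0 ≤ Z := integral_nonneg fun x => sq_nonneg _
    have hP0 : 0 ≤ P := integral_nonneg fun x => frobeniusNormSq_nonneg _
    have hD0 : 0 ≤ M * Real.sqrt Z * Real.sqrt P := by positivity
    have hJK : |∫ x, ⟪Literature.Analysis.FluidPDE.curl (u t) x, fderiv ℝ (u t) x (Literature.Analysis.FluidPDE.curl (u t) x)⟫_ℝ| ≤ kStar * M * Real.sqrt Z * Real.sqrt P := hFW t ht0 M hM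
    by_cases htS : t ∈ S
    · have hkt : k t = kStar - ηm := by simp [hk, Set.indicator_of_mem htS]
      rw [hkt]
      obtain ⟨-, hlockt, x₀, hx₀⟩ := hSsub htS
      have hcrowd : Real.sqrt Z * Real.sqrt P ≤ N * M ^ 2 := by
        calc Real.sqrt Z * Real.sqrt P ≤ N * ‖u t x₀‖ ^ 2 := hx₀
          _ ≤ N * M ^ 2 := by
            have := hM x₀
            have h2 : ‖u t x₀‖ ^ 2 ≤ M ^ 2 := pow_le_pow_left₀ (norm_nonneg _) this 2
            exact mul_le_mul_of_nonneg_left h2 hN.le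
      obtain ⟨A, ρ, hρ, hder, hAM, hrρ⟩ := hA t ⟨ht.1, ht.2⟩
      have ht' : (t + T) / 2 ∈ Ioo 0 T := ⟨by linarith [ht0.1], by linarith [ht0.2]⟩
      obtain ⟨qq, hsolt, hut, -, -⟩ := stub_taoCover hν hT hsol hLH hdec ht'
      have htI : t ∈ Icc 0 ((t + T) / 2) := ⟨ht0.1, by linarith [ht0.2]⟩
      obtain ⟨C₀, hC₀⟩ := hut 0
      obtain ⟨C₁, hC₁⟩ := hut 1
      obtain ⟨C₂, hC₂⟩ := hut 2
      obtain ⟨B₁, -, hB₁⟩ := exists_forall_norm_fderiv_le_of_hasBoundedSobolevNormsOn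
        (fun s hs => (hsolt.contDiff_velocity hs).of_le (by norm_cast)) hut
      have h0 : ∫⁻ x, ‖iteratedFDeriv ℝ 0 (u t) x‖ₑ ^ 2 < ⊤ := (hC₀ t htI).trans_lt ENNReal.coe_lt_top
      have h1 : ∫⁻ x, ‖iteratedFDeriv ℝ 1 (u t) x‖ₑ ^ 2 < ⊤ := (hC₁ t htI).trans_lt ENNReal.coe_lt_top
      have h2 : ∫⁻ x, ‖iteratedFDeriv ℝ 2 (u t) x‖ₑ ^ 2 < ⊤ := (hC₂ t htI).trans_lt ENNReal.coe_lt_top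
      have hcd : ContDiff ℝ (⊤ : ℕ∞) (u t) := hsol.contDiff_velocity ht0
      have hdiv : VectorCalculus.IsDivFree (u t) := hsol.divFree t ht0
      have hνt : 0 ≤ ν * (T - t) := by have := ht.2; nlinarith [hν.le]
      have hqZ : q * Z ≤ ρ ^ 2 * P := by
        have h1' : Z ≤ m * (ν * (T - t)) * P := by
          calc Z ≤ c₂ * (ν * (T - t)) * P := hlockt
            _ ≤ m * (ν * (T - t)) * P := by
              have := mul_le_mul_of_nonneg_right (mul_le_mul_of_nonneg_right hc₂m hνt) hP0
              exact this
        have h2' : r * (m * (ν * (T - t)) * P) ≤ m * (ρ ^ 2 * P) := by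
          have h3 : m * (r * (ν * (T - t))) ≤ m * ρ ^ 2 := mul_le_mul_of_nonneg_left hrρ hm0.le
          have h4 : m * (r * (ν * (T - t))) * P ≤ m * ρ ^ 2 * P := mul_le_mul_of_nonneg_right h3 hP0
          calc r * (m * (ν * (T - t)) * P) = m * (r * (ν * (T - t))) * P := by ring
            _ ≤ m * ρ ^ 2 * P := h4
            _ = m * (ρ ^ 2 * P) := by ring
        rw [hq, div_mul_eq_mul_div, div_le_iff₀ hm0]
        calc r * Z ≤ r * (m * (ν * (T - t)) * P) := mul_le_mul_of_nonneg_left h1' hr.le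
          _ ≤ m * (ρ ^ 2 * P) := h2'
          _ = ρ ^ 2 * P * m := by ring
      have hS1t := hslack (u t) M B₁ A ρ hcd hdiv hM (hB₁ t htI) h0 h1 h2 hρ hder (hAM M hM) hqZ hcrowd
      calc |∫ x, ⟪Literature.Analysis.FluidPDE.curl (u t) x, fderiv ℝ (u t) x (Literature.Analysis.FluidPDE.curl (u t) x)⟫_ℝ| ≤ (kStar - η) * M * Real.sqrt Z * Real.sqrt P := hS1t
        _ ≤ (kStar - ηm) * M * Real.sqrt Z * Real.sqrt P := by
          have : (kStar - η) ≤ (kStar - ηm) := by linarith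
          calc (kStar - η) * M * Real.sqrt Z * Real.sqrt P = (kStar - η) * (M * Real.sqrt Z * Real.sqrt P) := by ring
            _ ≤ (kStar - ηm) * (M * Real.sqrt Z * Real.sqrt P) := mul_le_mul_of_nonneg_right this hD0
            _ = (kStar - ηm) * M * Real.sqrt Z * Real.sqrt P := by ring
    · have hkt : k t = kStar := by simp [hk, Set.indicator_of_notMem htS]
      rw [hkt]; exact hJK
  · intro t ht
    have hKκ : kStar ≤ κ := kStar_le_of_universal hκ
    have hκ0 : 0 ≤ κ := le_trans hK0.le hKκ
    have hL0 : 0 ≤ Real.log ((T - t₁) / (T - t)) := by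
      apply Real.log_nonneg
      rw [le_div_iff₀ (by linarith [ht.2])]; linarith [ht.1]
    set L : ℝ := Real.log ((T - t₁) / (T - t)) with hLdef
    have hInd : IntervalIntegrable (fun s => S.indicator (fun _ => (1:ℝ)) s / (T - s)) volume t₁ t := by
      have h := intervalIntegrable_coeff_sq_div (k := S.indicator (fun _ => (1:ℝ))) (T := T)
        (measurable_const.indicator hSm) (fun τ => by rcases hind01 τ with h | h <;> simp [h]) ht.1 ht.2
      refine h.congr ?_
      · intro s _
        rcases hind01 s with h | h <;> simp [h]
    have hConst : IntervalIntegrable (fun s => kStar ^ 2 / (T - s)) volume t₁ t := by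
      apply ContinuousOn.intervalIntegrable
      apply ContinuousOn.div continuousOn_const (continuousOn_const.sub continuousOn_id)
      intro s hs
      rw [Set.uIcc_of_le ht.1] at hs
      have hsT : s < T := lt_of_le_of_lt hs.2 ht.2
      have hTs : T - s ≠ 0 := sub_ne_zero.mpr (ne_of_gt hsT)
      simpa [id] using hTs
    have hrew : ∫ τ in t₁..t, k τ ^ 2 / (T - τ)
        = ∫ τ in t₁..t, (kStar ^ 2 / (T - τ) - δ * (S.indicator (fun _ => (1:ℝ)) τ / (T - τ))) := by
      apply intervalIntegral.integral_congr
      intro τ _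
      simp only [hksq τ]; ring
    rw [hrew, intervalIntegral.integral_sub hConst (hInd.const_mul δ), intervalIntegral.integral_const_mul,
      integral_const_div_sub ht.1 ht.2]
    have hdens' := hdens t ht
    have hstep : kStar ^ 2 * L - δ * ∫ τ in t₁..t, S.indicator (fun _ => (1:ℝ)) τ / (T - τ)
        ≤ (kStar ^ 2 - δ * d) * L + δ * c := by
      have h1 : δ * (d₀ * L - c) ≤ δ * ∫ τ in t₁..t, S.indicator (fun _ => (1:ℝ)) τ / (T - τ) :=
        mul_le_mul_of_nonneg_left hdens' hδ0.le
      have h2 : δ * d * L ≤ δ * d₀ * L := by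
        have := mul_le_mul_of_nonneg_left hdd₀ hδ0.le
        exact mul_le_mul_of_nonneg_right this hL0
      nlinarith
    have hθK : (kStar ^ 2 - δ * d) = (θ * kStar) ^ 2 := by
      rw [mul_pow, hθsq]; field_simp
    have hθκ : (θ * kStar) ^ 2 * L ≤ (θ * κ) ^ 2 * L := by
      apply mul_le_mul_of_nonneg_right _ hL0
      rw [mul_pow, mul_pow]
      exact mul_le_mul_of_nonneg_left (pow_le_pow_left₀ hK0.le hKκ 2) (sq_nonneg _)
    calc kStar ^ 2 * L - δ * ∫ τ in t₁..t, S.indicator (fun _ => (1:ℝ)) τ / (T - τ)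
        ≤ (kStar ^ 2 - δ * d) * L + δ * c := hstep
      _ = (θ * kStar) ^ 2 * L + δ * c := by rw [hθK]
      _ ≤ (θ * κ) ^ 2 * L + δ * c := by linarith

/- NOTE. The tree's locked-times density + S3 (inefficiency of crowded slices) do NOT give S3′ and S3′ does not give S3: the two
compositions are independent cuts of the same enemy (crowd-dominated blow-up); a lead may pick either. -/

end Summit.NavierStokesRegularity.NavierStokesRegularity.Cruxes.NearExtremalTransience.StaticSlack
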